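import Summits.BirchSwinnertonDyer.BirchSwinnertonDyer.Theorems.BiquadraticEisensteinDescentEisensteinHeartFlatCMInertBadKPrimeOfV4KOfKatz
import HarnessLib

set_option linter.dupNamespace false -- `Summit.BirchSwinnertonDyer.BirchSwinnertonDyer.Theorems.…` (summit = sub, D-0017)
set_option autoImplicit false

/-!
# Crux `EisensteinHeartFlatCMInertBadKPrime` (stmt-BirchSwinnertonDyer-21341), line `hsieh_lambda` v5:
# the crux FROM ONE PRINT FACT (Katz–Hida–Tilouine) AND THE INPUT V4K — Hsieh's Theorem A is NOT needed

Route `BiquadraticEisensteinDescent` (cell `pub/bsd-wall`, lead-prover seat `bsd-wall-cm-bed-p1` g7). THEOREMS ONLY;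
supports, does not close, stmt-BirchSwinnertonDyer-21341.

## The observation (lead g7)

In the landed one-theorem form of the line (p647756 `…OfV4K.eisensteinHeartFlatCMInertBadKPrime_of_V4K_of_facts`,
Deuring-free as p701422 `…OfV4KOfKatz.…_of_V4K_of_katz_of_thmA`) Hsieh's Theorem A (the named fact
`Hsieh2014.thmA_exists_isHsiehLFunction_unrPeriod_anyLevel`, route support item `HsiehAnyLevelInput` 20456) enters in
exactly ONE place: it supplies a Hsieh witness `Q_H` (`IsHsiehLFunction ι′ 𝔭 κ γ f A Ω_K C Ω_p Q_H`) that BRIDGES the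
tied Katz line series `G` (`KatzCM.IsBaseChangeLine`, compared with `Q_H` by `…KatzHsiehDisplay.exists_span_C_mul_eq`)
and the crux's GIVEN ♭-frame `Q` (`X11b.R1.IsBDPLFunctionInt p ι′ 𝔭 κ γ f Ω_K Ω_p Q`, compared with `Q_H` by
`X11b.span_singleton_eq_of_isHsiehLFunction_of_isBDPLFunctionInt`). But at a prime `p ∣ N` the crux's own `Q` IS a
Hsieh witness: Hsieh's display and Castella's display differ by the factor `C · p^{n} / (A^{2n} 4^{2n})`
(`hsiehInterpolationValue_eq_mul_bdpInterpolationValue`), which is IDENTICALLY `1` for `A = √p / 4`, `C = 1`.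
Hence `IsBDPLFunctionInt … Ω_K Ω_p Q → IsHsiehLFunction … (√p/4) Ω_K 1 Ω_p Q` (`isHsiehLFunction_of_isBDPLFunctionInt`,
§1), the V2 display compares `G` with `Q` directly, and the ideal-rigidity step disappears. The composition of
p647756 with this substitution is **`eisensteinHeartFlatCMInertBadKPrime_of_V4K_of_katz`** (§2):

  `hsieh2014mu_prop49_exists_isMeasure → V4K → EisensteinHeartFlatCMInertBadKPrime`

(Deuring's theorem supplied by the kernel theorem `…DeuringOfCore.Deuring_exists_heckeCharacter_of_maximalCM_holds`,
p698052). So the crux's residue is ONE print fact (Katz 1978 (5.3.0) / Hida–Tilouine 1993 Thm II / Hsieh Crelle 688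
Prop 4.9, typed as `hsieh2014mu_prop49_exists_isMeasure`) and ONE research statement (V4K, verbatim the registered
stub `stub_V4K`); item 20456 (`HsiehAnyLevelInput`) is no longer on 21341's path. HONEST STATUS: conditional
(`proof.conditional` on hKatz, hV4K); nothing about any case of BSD is asserted; 21341 stays OPEN.
-/

noncomputable section

open scoped Classical NumberField

open WeierstrassCurve NumberField IsDedekindDomain Field PowerSeries
  Literature.NumberTheory.EllipticCurves Literature.NumberTheory.EllipticCurves.ModularForms
  Literature.NumberTheory.EllipticCurves.Rank1Residual
  Literature.NumberTheory.EllipticCurves.Hsieh2014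
  Literature.NumberTheory.EllipticCurves.GreenbergSelmer
  Literature.NumberTheory.EllipticCurves.Module
  Literature.NumberTheory.EllipticCurves.IwasawaDual
  Literature.NumberTheory.GaloisRepresentations
  Summit.BirchSwinnertonDyer.Rank1Residual Summit.BirchSwinnertonDyer.Rank1Residual.X11b
  Summit.BirchSwinnertonDyer.Rank1Residual.X11b.AcSelmer
  Summit.BirchSwinnertonDyer.BirchSwinnertonDyer.Theorems.BiquadraticEisensteinDescentDefs
  Summit.BirchSwinnertonDyer.BirchSwinnertonDyer.Theorems.BiquadraticEisensteinDescentEisensteinHeartFlatCMInertBadKPrimeSelmerTower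
  Summit.BirchSwinnertonDyer.BirchSwinnertonDyer.Theorems.BiquadraticEisensteinDescentEisensteinHeartFlatCMInertBadKPrimeShapiroDatum
  Summit.BirchSwinnertonDyer.BirchSwinnertonDyer.Theorems.BiquadraticEisensteinDescentEisensteinHeartFlatCMInertBadKPrimeCMDatumAdapter

namespace Summit.BirchSwinnertonDyer.BirchSwinnertonDyer.Theorems.BiquadraticEisensteinDescentEisensteinHeartFlatCMInertBadKPrimeOfV4KOfKatzOnly

open Summit.BirchSwinnertonDyer.BirchSwinnertonDyer.Theses.BiquadraticEisensteinDescent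
open Summit.BirchSwinnertonDyer.BirchSwinnertonDyer.Theorems.BiquadraticEisensteinDescentEisensteinHeartFlatCMInertBadKPrimeCMDatumAdapter

/-! ### §1 The ♭-frame is its own Hsieh witness at `p ∣ N` -/

/-- **Castella's display ⟹ Hsieh's display, on the nose, at `p ∣ N`.** If `Q ∈ 𝓞_{ℂ_p}⟦T⟧` has Castella's
interpolation property `R1.IsBDPLFunctionInt p ι′ 𝔭 κ γ f Ω_K Ω_p Q` (Castella 2018 Thm. 3.1 shape) and `p ∣ N`, then
`Q` has Hsieh's interpolation property `IsHsiehLFunction ι′ 𝔭 κ γ f (√p/4) Ω_K 1 Ω_p Q` (Hsieh Doc. Math. 19 Thm. A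
shape) with archimedean constant `A = √p/4 > 0`, the SAME periods and constant `C = 1` (`‖ι′⁻¹ 1‖ = 1`): by
`hsiehInterpolationValue_eq_mul_bdpInterpolationValue` the two displays differ by `C·p^{n}/(A^{2n}4^{2n}) =
p^{n}/((√p/4)·4)^{2n} = 1`. [cite: Hsieh2014, Thm. A p. 712 (Doc. Math. 19) = Thm. 1 (arXiv:1112.1580 p. 4)]
[cite: Castella2018, Thm. 3.1 (arXiv:1704.06608 p. 9)] -/
theorem isHsiehLFunction_of_isBDPLFunctionInt {p : ℕ} [Fact p.Prime] {K : Type} [Field K] [NumberField K]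
    {N : ℕ} (hpN : p ∣ N) {ι' : PadicAlgCl p ≃+* ℂ} {𝔭 : HeightOneSpectrum (𝓞 K)} {κ : ZpExtension K p}
    {γ : absoluteGaloisGroup K} {f : CuspForm (CongruenceSubgroup.Gamma0 N) 2} {ΩK : ℂ} {Ωp : ℂ_[p]}
    {Q : PowerSeries 𝓞_ℂ_[p]} (hQ : R1.IsBDPLFunctionInt p ι' 𝔭 κ γ f ΩK Ωp Q) :
    IsHsiehLFunction ι' 𝔭 κ γ f (Real.sqrt p / 4) ΩK 1 Ωp Q := by
  intro χ n hn hunr hinf r hr hκ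
  have hv := hQ χ n hn hunr hinf r hr hκ
  have hp : p.Prime := Fact.out
  have hp0 : (p : ℂ) ≠ 0 := by exact_mod_cast hp.ne_zero
  have hsq : (((Real.sqrt p / 4 : ℝ) : ℂ) ^ (2 * n) * (4 : ℂ) ^ (2 * n)) = (p : ℂ) ^ n := by
    rw [← mul_pow, Complex.ofReal_div, Complex.ofReal_ofNat, div_mul_cancel₀ _ (by norm_num : (4 : ℂ) ≠ 0),
      pow_mul, ← Complex.ofReal_pow, Real.sq_sqrt (Nat.cast_nonneg p), Complex.ofReal_natCast]
  have hfac : (1 : ℂ) * (if p ∣ N then (p : ℂ) ^ n else 1) /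
      (((Real.sqrt p / 4 : ℝ) : ℂ) ^ (2 * n) * (4 : ℂ) ^ (2 * n)) = 1 := by
    rw [if_pos hpN, hsq, one_mul, div_self (pow_ne_zero _ hp0)]
  rwa [hsiehInterpolationValue_eq_mul_bdpInterpolationValue, hfac, one_mul]

/-- `0 < √p / 4`. [folklore] -/
theorem sqrt_div_four_pos {p : ℕ} [Fact p.Prime] : 0 < Real.sqrt p / 4 :=
  div_pos (Real.sqrt_pos.mpr (by exact_mod_cast (Fact.out : p.Prime).pos)) (by norm_num)

/-- `‖ι′⁻¹ 1‖ = 1` in `ℂ_p`. [folklore] -/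
theorem norm_symm_one {p : ℕ} [Fact p.Prime] (ι' : PadicAlgCl p ≃+* ℂ) :
    ‖((ι'.symm (1 : ℂ) : PadicAlgCl p) : ℂ_[p])‖ = 1 := by
  rw [map_one, UniformSpace.Completion.coe_one, norm_one]

/-- **A Hsieh witness from the crux's own ♭-frame** — the conclusion shape of v3's `stub_hsiehWitness`
(`∃ A Ω_K C Ω_p Q_H, 0 < A ∧ Ω_K ≠ 0 ∧ ‖ι′⁻¹C‖ = 1 ∧ IsHsiehLFunction …`, closed there modulo Theorem A by p594900)
obtained WITHOUT Theorem A from any ♭-frame `(Ω_K ≠ 0, Ω_p ∈ R₀ˣ, Q)` of the datum at `p ∣ N`: the witness is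
`(√p/4, Ω_K, 1, Ω_p, Q)`. [cite: Hsieh2014, Thm. A p. 712 (Doc. Math. 19)] [cite: Castella2018, Thm. 3.1 (arXiv:1704.06608 p. 9)] -/
theorem exists_hsiehWitness_of_isBDPLFunctionInt {p : ℕ} [Fact p.Prime] {K : Type} [Field K] [NumberField K]
    {N : ℕ} (hpN : p ∣ N) {ι' : PadicAlgCl p ≃+* ℂ} {𝔭 : HeightOneSpectrum (𝓞 K)} {κ : ZpExtension K p}
    {γ : absoluteGaloisGroup K} {f : CuspForm (CongruenceSubgroup.Gamma0 N) 2} {ΩK : ℂ} (hΩK : ΩK ≠ 0)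
    {Ωp : (unrIntegers p)ˣ} {Q : PowerSeries 𝓞_ℂ_[p]}
    (hQ : R1.IsBDPLFunctionInt p ι' 𝔭 κ γ f ΩK ((Ωp : unrIntegers p) : ℂ_[p]) Q) :
    ∃ (A : ℝ) (ΩK' C : ℂ) (Ωp' : (unrIntegers p)ˣ) (QH : PowerSeries (PadicComplexInt p)),
      0 < A ∧ ΩK' ≠ 0 ∧ ‖((ι'.symm C : PadicAlgCl p) : ℂ_[p])‖ = 1 ∧
        IsHsiehLFunction ι' 𝔭 κ γ f A ΩK' C ((Ωp' : unrIntegers p) : ℂ_[p]) QH :=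
  ⟨Real.sqrt p / 4, ΩK, 1, Ωp, Q, sqrt_div_four_pos, hΩK, norm_symm_one ι', isHsiehLFunction_of_isBDPLFunctionInt hpN hQ⟩

/-! ### §2 The crux from (Katz) and the input V4K -/

/-- **The ♭-heart crux from (Katz) Katz–Hida–Tilouine + the input V4K — WITHOUT Hsieh's Theorem A.** p647756's
`eisensteinHeartFlatCMInertBadKPrime_of_V4K_of_facts` with (i) Deuring's Grössencharacter theorem supplied by the kernel
theorem `Deuring_exists_heckeCharacter_of_maximalCM_holds` (as in p701422) and (ii) the Hsieh witness `(A, Ω_K′, C, Ω_p, Q_H)`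
replaced by `(√p/4, Ω_K, 1, Ω_p, Q)` — the crux's own ♭-frame read as a Hsieh witness (§1) —, so that the V2 display
`…KatzHsiehDisplay.exists_span_C_mul_eq` compares the tied Katz line series `G` with `Q` itself and no ideal rigidity
across witnesses is needed. The binder `hV4K` is p647756's VERBATIM (= the registered stub `stub_V4K`).
[cite: Hsieh2014mu, Prop. 4.9 (§4.8)] [cite: Katz1978, Thm. (5.3.0)] [cite: HidaTilouine1993, Thm. II]
[cite: Castella2018, Thm. 3.1 (arXiv:1704.06608 p. 9)] -/
theorem eisensteinHeartFlatCMInertBadKPrime_of_V4K_of_katz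
    (hKatz : hsieh2014mu_prop49_exists_isMeasure)
    (hV4K : ∀ (W : WeierstrassCurve ℚ) [W.IsElliptic] [W.IsGloballyMinimal] (p : ℕ) [Fact p.Prime]
        [NeZero (W.conductorNorm ℤ)] (K : Type) [Field K] [NumberField K],
        W.HasCM → 5 ≤ p → CMInert W p → ¬ Good W p →
        IsImaginaryQuadratic K → SatisfiesHeegnerHypothesis (W.conductorNorm ℤ) K →
        4 < (NumberField.discr K).natAbs → ¬ p ∣ NumberField.classNumber K →
        ∀ (κ : ZpExtension K p), κ.IsAnticyclotomic →
          ∀ (γ : Field.absoluteGaloisGroup K) [Fact (κ.IsTopGenerator γ)]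
            (𝔭 : HeightOneSpectrum (𝓞 K)), ((p : ℕ) : 𝓞 K) ∈ 𝔭.asIdeal →
            𝔭.asIdeal.ramificationIdx (𝓞 ℚ) = 1 → 𝔭.asIdeal.inertiaDeg (𝓞 ℚ) = 1 →
            ∀ (f : CuspForm (CongruenceSubgroup.Gamma0 (W.conductorNorm ℤ)) 2), IsNewformOf W f →
              ∀ (ι' : PadicAlgCl p ≃+* ℂ),
                (∀ (w : InfinitePlace K) (k : 𝓞 K), k ∈ 𝔭.asIdeal ↔ ‖ι'.symm (w.embedding (k : K))‖ < 1) →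
                    ∀ (𝔭' : HeightOneSpectrum (𝓞 K)), ((p : ℕ) : 𝓞 K) ∈ 𝔭'.asIdeal → 𝔭' ≠ 𝔭 →
                    Module.IsTorsion (IwasawaAlgebra p) (XAc (W.baseChange K) p κ 𝔭' ∅ γ) →
                    ∀ (L : Type) [Field L] [NumberField L] [Algebra K L] [IsGalois K L]
                      (Sp S T : Finset (HeightOneSpectrum (𝓞 L))) (lam : HeckeCharacter L) (ϑ : L) (CK : ℂ)
                      (Ω : InfinitePlace L → ℂ) (ΩpK : InfinitePlace L → ℂ_[p]) (G : PowerSeries 𝓞_ℂ_[p])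
                      (w₁ w₂ : InfinitePlace L) (cL cL' : ℂ),
                      w₁ ≠ w₂ → (∀ w : InfinitePlace L, w = w₁ ∨ w = w₂) →
                      (∀ (χ : HeckeCharacter K) (n : ℕ), 0 < n → (∀ v : HeightOneSpectrum (𝓞 K), χ.IsUnramifiedAt v) →
                        χ.HasInfinityType (fun _ ↦ (n : ℤ)) (fun _ ↦ -(n : ℤ)) →
                        KatzCM.HasKatzType ι' Sp (lam * χ.compRelNorm L) 1 (fun w ↦ if w = w₁ then n else n - 1)) →
                      (∀ (χ : HeckeCharacter K) (n : ℕ), 0 < n → (∀ v : HeightOneSpectrum (𝓞 K), χ.IsUnramifiedAt v) →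
                        χ.HasInfinityType (fun _ ↦ (n : ℤ)) (fun _ ↦ -(n : ℤ)) →
                        LFunction.HasEntireContinuation (heckeLFunction (lam * χ.compRelNorm L))) →
                      cL ≠ 0 → cL' ≠ 0 →
                      (∀ (χ : HeckeCharacter K) (n : ℕ), 0 < n → (∀ v : HeightOneSpectrum (𝓞 K), χ.IsUnramifiedAt v) →
                        χ.HasInfinityType (fun _ ↦ (n : ℤ)) (fun _ ↦ -(n : ℤ)) →
                        ∀ hL : LFunction.HasEntireContinuation (heckeLFunction (lam * χ.compRelNorm L)),
                          hL.continuation 0 = cL * cL' ^ n * rankinSelbergValueHecke f χ 1) →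
                      (∀ w ∈ S ∪ KatzCM.primesOver L p, ¬ lam.IsUnramifiedAt w) →
                      (∀ w ∈ Sp ∪ T, ¬ lam.IsUnramifiedAt w) →
                      CK ≠ 0 → (∀ w, Ω w ≠ 0) → (∀ w, (KatzCM.embeddingAt ι' Sp w ϑ).im ≠ 0) → (∀ w, ΩpK w ≠ 0) →
                      KatzCM.IsBaseChangeLine ι' Sp S T κ γ lam ϑ CK Ω ΩpK G →
                    ∀ (d₀ : ℤ) (r : AlgebraicClosure K) (ψ : (W.baseChange K).geomPoints →+ (W.baseChange K).geomPoints),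
                      r * r = algebraMap K (AlgebraicClosure K) (d₀ : K) →
                      r ∉ Set.range (algebraMap K (AlgebraicClosure K)) →
                      (∀ y : ZMod p, y * y ≠ PadicInt.toZMod ((d₀ : ℤ) : ℤ_[p])) →
                      (∀ σ : absoluteGaloisGroup K, σ • r = r → ∀ P : (W.baseChange K).geomPoints, σ • ψ P = ψ (σ • P)) →
                      (∀ σ : absoluteGaloisGroup K, σ • r = -r → ∀ P : (W.baseChange K).geomPoints, σ • ψ P = -ψ (σ • P)) →
                      (∀ P, ψ (ψ P) = d₀ • P) →
                    ∀ (U : Subgroup (absoluteGaloisGroup K)) [U.Normal], (∀ σ, σ ∈ U ↔ σ • r = r) →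
                    ∀ (φ : (W.baseChange K).geomPrimaryTorsion p →+ (W.baseChange K).geomPrimaryTorsion p)
                      (_ : ∀ m, ((φ m : (W.baseChange K).geomPrimaryTorsion p) : (W.baseChange K).geomPoints) = ψ m)
                      (hφH' : ∀ (x : (κ.kerSubgroup ⊓ U : Subgroup (absoluteGaloisGroup K)))
                        (m : (W.baseChange K).geomPrimaryTorsion p), φ (x • m) = x • φ m)
                      (hφU : ∀ σ ∈ U, ∀ m : (W.baseChange K).geomPrimaryTorsion p, φ (σ • m) = σ • φ m)
                      (hφU' : ∀ σ, σ ∉ U → ∀ m : (W.baseChange K).geomPrimaryTorsion p, φ (σ • m) = -(σ • φ m))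
                      (hφ2 : ∀ m, φ (φ m) = d₀ • m)
                      (γ' : absoluteGaloisGroup K) (_ : κ.IsTopGenerator γ') (_ : γ' ∈ U)
                      (f₁ : AddMonoid.End (selmerOver (κ.kerSubgroup ⊓ U) ((W.baseChange K).geomPrimaryTorsion p) p 𝔭' ∅))
                      (_hf : ∀ s, ((f₁ s : selmerOver (κ.kerSubgroup ⊓ U) ((W.baseChange K).geomPrimaryTorsion p) p 𝔭' ∅) :
                        subgroupH1 (κ.kerSubgroup ⊓ U) ((W.baseChange K).geomPrimaryTorsion p)) =
                          conjH1 (κ.kerSubgroup ⊓ U) ((W.baseChange K).geomPrimaryTorsion p) γ' s)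
                      (h : IsLocNil p (f₁ - 1))
                      (δ : LocNilDual (selmerOver (κ.kerSubgroup ⊓ U) ((W.baseChange K).geomPrimaryTorsion p) p 𝔭' ∅) f₁ h
                        →ₗ[IwasawaAlgebra p]
                        LocNilDual (selmerOver (κ.kerSubgroup ⊓ U) ((W.baseChange K).geomPrimaryTorsion p) p 𝔭' ∅) f₁ h)
                      (hδ : ∀ (x : LocNilDual (selmerOver (κ.kerSubgroup ⊓ U) ((W.baseChange K).geomPrimaryTorsion p) p 𝔭' ∅) f₁ h)
                        (s t : selmerOver (κ.kerSubgroup ⊓ U) ((W.baseChange K).geomPrimaryTorsion p) p 𝔭' ∅),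
                        (t : subgroupH1 (κ.kerSubgroup ⊓ U) ((W.baseChange K).geomPrimaryTorsion p)) =
                          resH1Hom (ContinuousMonoidHom.id _) φ hφH'
                            (s : subgroupH1 (κ.kerSubgroup ⊓ U) ((W.baseChange K).geomPrimaryTorsion p)) → δ x s = x t)
                      (b : Module.Basis (Fin 2) ℤ_[p]
                        (AdjoinRoot (Polynomial.X ^ 2 - Polynomial.C ((d₀ : ℤ) : ℤ_[p]) : Polynomial ℤ_[p]))) (hb0 : b 0 = 1)
                      (hb1 : b 1 * b 1 = algebraMap ℤ_[p]
                        (AdjoinRoot (Polynomial.X ^ 2 - Polynomial.C ((d₀ : ℤ) : ℤ_[p]) : Polynomial ℤ_[p])) ((d₀ : ℤ) : ℤ_[p]))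
                      (ι : AdjoinRoot (Polynomial.X ^ 2 - Polynomial.C ((d₀ : ℤ) : ℤ_[p]) : Polynomial ℤ_[p]) →+* 𝓞_ℂ_[p])
                      (_ : ι.comp (algebraMap ℤ_[p] _) = R1.toCpInt p),
                      ∃ m : ℕ, ∀ x ∈ (charIdeal (PowerSeries
                          (AdjoinRoot (Polynomial.X ^ 2 - Polynomial.C ((d₀ : ℤ) : ℤ_[p]) : Polynomial ℤ_[p])))
                          (WithQuadratic (LocNilDual (selmerOver (κ.kerSubgroup ⊓ U) ((W.baseChange K).geomPrimaryTorsion p)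
                            p 𝔭' ∅) f₁ h) b hb0 hb1 δ
                            (delta_sq (W.baseChange K) κ 𝔭' ∅ U φ hφH' hφU hφU' d₀ hφ2 f₁ h δ hδ))).map (PowerSeries.map ι),
                        (PowerSeries.C ((p : ℕ) : 𝓞_ℂ_[p]) : PowerSeries 𝓞_ℂ_[p]) ^ m * x ∈ Ideal.span {G}) :
    EisensteinHeartFlatCMInertBadKPrime := by
  intro W _ _ p _ _ K _ _ hCM _hr hp5 hin hbad hK hHN hd4 hh _hLt κ hκ γ _ 𝔭 h𝔭 he hf1 f hf ι' hι ΩK Ωp Q hΩK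
    hQ 𝔭' h𝔭' hne htors
  have hp : p.Prime := Fact.out
  have hp2 : p ≠ 2 := by omega
  have hpN : p ∣ W.conductorNorm ℤ := (W.dvd_conductorNorm_iff_not_hasGoodReductionAtPrime p).mpr hbad
  have hγ : κ.IsTopGenerator γ := Fact.out
  -- the ♭-frame `Q` is its own Hsieh witness (A = √p/4, C = 1)
  have hQH : IsHsiehLFunction ι' 𝔭 κ γ f (Real.sqrt p / 4) ΩK 1 ((Ωp : unrIntegers p) : ℂ_[p]) Q :=
    isHsiehLFunction_of_isBDPLFunctionInt hpN hQ
  have hA : (0 : ℝ) < Real.sqrt p / 4 := sqrt_div_four_pos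
  -- the CM endomorphism `[√d₀]` over `K′` and the index-two subgroup `U = Γ_L`
  obtain ⟨d₀, r, ψ, hr, hrK, hd, hψU, hψU', hψ2⟩ := Summit.BirchSwinnertonDyer.BirchSwinnertonDyer.Theorems.BiquadraticEisensteinDescentEisensteinHeartFlatCMInertBadKPrimeSqrtEndomorphismAllJ.stub_sqrtEndomorphism
      W p K hCM hp5 hin hbad hK hHN 𝔭 𝔭' h𝔭 h𝔭' hne
  let U : Subgroup (absoluteGaloisGroup K) := MulAction.stabilizer (absoluteGaloisGroup K) r
  have hUr : ∀ σ, σ ∈ U ↔ σ • r = r := fun σ ↦ MulAction.mem_stabilizer_iff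
  haveI : U.Normal := normal_of_forall_mem_iff r (d₀ : K) hr hrK U hUr
  haveI : (W.baseChange K).IsElliptic := inferInstanceAs (W.map (algebraMap ℚ K)).IsElliptic
  haveI : Module.Finite (IwasawaAlgebra p) (XAc (W.baseChange K) p κ 𝔭' ∅ γ) := XAc.module_finite_empty κ 𝔭' γ
  have hΩp : ((Ωp : unrIntegers p) : ℂ_[p]) ≠ 0 := by
    rw [Ne, ZeroMemClass.coe_eq_zero]
    exact Ωp.ne_zero
  -- V3 (Shapiro, one call) + [V2 frame ∧ V4K input ∧ Katz display against `Q`] for the upper module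
  have hap : cuspCoeff f p = 0 :=
    Summit.BirchSwinnertonDyer.BirchSwinnertonDyer.Theorems.BiquadraticEisensteinDescentEisensteinHeartFlatCMInertBadKPrimeCuspCoeffVanishing.cuspCoeff_eq_zero_of_hasCM_of_not_good
      hCM hbad hf
  refine heartShape_xac_of_sqrt_endomorphism (W.baseChange K) κ 𝔭' ∅ U hp2 γ ψ d₀ r hr hrK hUr hψU hψU' hψ2 hd htors ?_
  intro φ hφψ hφH' hφU hφU' hφ2 γ' hγ' hγ'U f₁ hf₁ h δ hδ b hb0 hb1 ιO hιO
  -- the tied Katz line frame (Katz + Deuring, the latter a kernel theorem)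
  obtain ⟨L, _, _, _, _, Sp, S, T, lam, ϑ, CK, Ω, ΩpK, G, w₁, w₂, cL, cL', hw, huniv, hT, hcont, hcL, hcL', hLval, hramS,
    hramT, hCK, hΩ, hIm, hΩpK, hGK⟩ :=
    Summit.BirchSwinnertonDyer.BirchSwinnertonDyer.Theorems.BiquadraticEisensteinDescentEisensteinHeartFlatCMInertBadKPrimeStubV2AllJ.stub_V2_of_katz_of_deuring
      hKatz
      Summit.BirchSwinnertonDyer.BirchSwinnertonDyer.Theorems.BiquadraticEisensteinDescentDeuringOfCore.Deuring_exists_heckeCharacter_of_maximalCM_holds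
      W p K hCM hp5 hin hbad hK hHN hd4 hh κ hκ γ 𝔭 h𝔭 he hf1 f hf ι' hι 𝔭' h𝔭' hne
  -- THE INPUT for `G`
  obtain ⟨m, hm⟩ := hV4K W p K hCM hp5 hin hbad hK hHN hd4 hh κ hκ γ 𝔭 h𝔭 he hf1 f hf ι' hι 𝔭' h𝔭' hne htors
    L Sp S T lam ϑ CK Ω ΩpK G w₁ w₂ cL cL' hw huniv hT hcont hcL hcL' hLval hramS hramT hCK hΩ hIm hΩpK hGK
    d₀ r ψ hr hrK hd hψU hψU' hψ2 U hUr φ hφψ hφH' hφU hφU' hφ2 γ' hγ' hγ'U f₁ hf₁ h δ hδ b hb0 hb1 ιO hιO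
  -- Katz display against the ♭-frame itself: `(c·G) = (c′·Q)`
  obtain ⟨c, c', hc, hc', hspan⟩ :=
    Summit.BirchSwinnertonDyer.BirchSwinnertonDyer.Theorems.BiquadraticEisensteinDescentEisensteinHeartFlatCMInertBadKPrimeKatzHsiehDisplay.exists_span_C_mul_eq
      hp2 hK hκ hγ hQH hGK hw huniv hT hcont hcL hcL' hLval hpN hap hramS hramT hCK hΩ hIm hΩpK hA.ne' hΩK one_ne_zero hΩp
  exact (Summit.BirchSwinnertonDyer.BirchSwinnertonDyer.Theorems.BiquadraticEisensteinDescentEisensteinHeartFlatCMInertBadKPrimeConstantScaling.heartShape_iff_of_span_C_mul_eq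
    hc hc' hspan _).mp ⟨m, hm⟩

end Summit.BirchSwinnertonDyer.BirchSwinnertonDyer.Theorems.BiquadraticEisensteinDescentEisensteinHeartFlatCMInertBadKPrimeOfV4KOfKatzOnly

end
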